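import Summits.QuantumFields.YangMills.Theorems.IR.AfPincerUcXCov
import Summits.QuantumFields.YangMills.Theorems.IR.AfPincerUcFormat
import Summits.QuantumFields.YangMills.Theorems.BalabanLadderIRAfOnsetCovariance

/-!
# Crux `IR` (stmt-QuantumFields-19354), line `af-pincer`, stub `stub_afOnsetUc : AFToOnsetUKPc` (X-side):
# compactly supported test functions, the X-clause and the registered statement from covariance hypotheses

Sequel of `Theorems/IR/AfPincerUcXCov` (seat ym-19354-afpincer-s2, generation 2).

* §2 **`afBelowScale_clause_of_covarianceAF_of_compact`** — for a COMPACTLY SUPPORTED `v` (with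
  `tsupport v ⊆ {y | 0 < y 0}`) the asymptotic-freedom WINDOW ALONE (no envelope) gives the clause
  `∀ η > 0 ∃ T β₁ ∀ β ≥ β₁ ∀ s > 0, T ≤ s·ℓ(β) → ∃ᶠ L, |Q2 G r β L s (θv) v| ≤ η`: a pair `(x, y)` contributes only
  if `s x, s y` lie in the ball of radius `ρ ⊇ tsupport v`, so there are no FAR pairs once `R ≥ 2ρ` and no WRAP pairs
  once `L ≥ 2ρ/s`.  Consequence for the planners: with a compactly supported non-triviality witness in `LowerBounds`
  (the NT desk's choice) the X-side of the pincer is a statement about the window `[0, ℓ(β)/T']` only; the crossover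
  envelope of `…XCov` is consumed by Schwartz TAILS.
* §3 `xClause_of_formatAtScale_of_afBelowScale` (cplan g10's contract lemma `afToOnset_clause_of_scale`, re-proved:
  LEAD's format at mesh `≤ B·ℓ(β)` + `AFBelowScaleAt ℓ` ⇒ the registered X-clause at `(G, r, n, ε, δ)`),
  **`xClause_of_covarianceAF_at_onset`** (envelope + window AT THE ONSET SCALE `ℓ = b⋆ = mixOnsetUc` ⇒ the X-clause;
  generation 0's «what is missing» as a kernel implication), **`afToOnsetUKPc_of_covarianceAF`** (the same at every
  parameter ⇒ `AFToOnsetUKPc` BY NAME — NOT a proof of the stub: both hypotheses are OPEN).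

* §4 **`covarianceAF_window_polyScale`** (NON-VACUITY of the window hypothesis): by the tree's volume-uniform bound
  `|Cov| ≤ W₁ (1+log β)²/β²` (`AfOnset.exists_abs_torusCov_dens_le`, generation 0) the asymptotic-freedom window HOLDS
  UNCONDITIONALLY at the polynomial scale `ℓ(β) = (β/(1+log β))^{1/4}`; the stub needs it at the onset scale `b⋆`
  (physically `≍ e^{cβ}`) — the same gap generation 0's box records, now on the hypothesis side.

HONEST FRAMING.  Kernel reductions of one open stub of one open gap-crux of a CONDITIONAL chain (Track A 0/28 UV) to
named open covariance statements; nothing here is asymptotic freedom, mixing, a gap or Clay.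
-/

set_option autoImplicit false

noncomputable section

open Filter Topology Finset MeasureTheory
open scoped BigOperators SchwartzMap
open Literature.MathematicalPhysics.QuantumFieldTheory hiding ZdEdge
open Literature.MathematicalPhysics.QuantumLattice
open Literature.Probability.LatticeModels (Site box mem_box)
open Summit.QuantumFields.YangMills.Cruxes.OSLegsFromFemtoAndGap.DlrCollarTransfer
open Summit.QuantumFields.YangMills.Theorems.OSLegsFromFemtoAndGap (mul_norm_le_norm_smul_siteToE)
open Summit.QuantumFields.YangMills.Theorems.InfiniteVolume (exists_abs_dens_le_uniform abs_torusCov_dens_le)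
open Summit.QuantumFields.YangMills.Cruxes.IR.AfOnset

namespace Summit.QuantumFields.YangMills.Cruxes.IR.AfPincerUc

variable {G : Type} [Group G] [TopologicalSpace G] [IsTopologicalGroup G] [CompactSpace G]
  [MeasurableSpace G] [BorelSpace G]

/-! ## §2 Compactly supported test functions: the asymptotic-freedom window alone suffices -/
section Compact

/-- Termwise: if both values are non-zero only for near, non-wrapping pairs, the window bound alone controls the term:
`|F G Cov| ≤ W·|F||G|(1+‖x−y‖)⁻⁸`. [folklore] -/
theorem abs_term_le_near_of_support {F G : EuclideanSpace ℝ (Fin 4) → ℝ} {c s R W : ℝ} {L : ℕ} (hW : 0 ≤ W)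
    (x y : Site 4) (haf : ‖x - y‖ ≤ (L : ℝ) → s * ‖x - y‖ ≤ R → |c| ≤ W / (1 + ‖x - y‖) ^ 8)
    (hsupp : F (s • siteToE x) ≠ 0 → G (s • siteToE y) ≠ 0 → s * ‖x - y‖ ≤ R ∧ ‖x - y‖ ≤ (L : ℝ)) :
    |F (s • siteToE x) * G (s • siteToE y) * c| ≤
      W * (|F (s • siteToE x)| * |G (s • siteToE y)| * ((1 + ‖x - y‖) ^ 8)⁻¹) := by
  have hRHS : 0 ≤ W * (|F (s • siteToE x)| * |G (s • siteToE y)| * ((1 + ‖x - y‖) ^ 8)⁻¹) := by positivity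
  by_cases hF : F (s • siteToE x) = 0
  · have h0 : |F (s • siteToE x) * G (s • siteToE y) * c| = 0 := by rw [hF, zero_mul, zero_mul, abs_zero]
    rw [h0]; exact hRHS
  by_cases hG : G (s • siteToE y) = 0
  · have h0 : |F (s • siteToE x) * G (s • siteToE y) * c| = 0 := by rw [hG, mul_zero, zero_mul, abs_zero]
    rw [h0]; exact hRHS
  obtain ⟨hR, hL⟩ := hsupp hF hG
  rw [abs_mul, abs_mul]
  calc |F (s • siteToE x)| * |G (s • siteToE y)| * |c|
      ≤ |F (s • siteToE x)| * |G (s • siteToE y)| * (W / (1 + ‖x - y‖) ^ 8) :=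
        mul_le_mul_of_nonneg_left (haf hL hR) (by positivity)
    _ = W * (|F (s • siteToE x)| * |G (s • siteToE y)| * ((1 + ‖x - y‖) ^ 8)⁻¹) := by ring

/-- The physical separation of two lattice points in the unit `s` dominates `s` times their sup distance:
`s ‖x − y‖ ≤ ‖s x − s y‖`. [folklore] -/
theorem mul_norm_sub_le_norm_smul_sub {s : ℝ} (hs : 0 ≤ s) (x y : Site 4) :
    s * ‖x - y‖ ≤ ‖s • siteToE x - s • siteToE y‖ := by
  have h := mul_norm_le_norm_smul_siteToE hs (x - y)
  rwa [Summit.QuantumFields.YangMills.Theorems.OSLegsFromFemtoAndGap.siteToE_sub, smul_sub] at h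

/-- **For a COMPACTLY SUPPORTED test function the asymptotic-freedom window ALONE gives the clause** (no envelope):
if `tsupport v ⊆ {y | 0 < y 0}` is compact then for every `η > 0` there are `T, β₁` with
`β ≥ β₁, s > 0, T ≤ s·ℓ(β) ⟹ ∃ᶠ L, |Q2 G r β L s (θv) v| ≤ η`.  Reason: a pair `(x, y)` contributes only if both `s x`
and `s y` lie in the ball of radius `ρ ⊇ tsupport v`, so `s‖x − y‖ ≤ 2ρ`: no FAR pairs once `R ≥ 2ρ` and no WRAP pairs
once `L ≥ 2ρ/s`.  (So with a compactly supported non-triviality witness in `LowerBounds` — the NT desk's choice — the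
X-side of the pincer is a statement about the window only.) [folklore reduction; the hypothesis is OPEN] -/
theorem afBelowScale_clause_of_covarianceAF_of_compact (r : LatticeRep G) (ℓ : ℝ → ℝ)
    (haf : ∀ W : ℝ, 0 < W → ∃ T' β₀ : ℝ, 0 < T' ∧ ∀ β : ℝ, β₀ ≤ β → ∀ᶠ L : ℕ in atTop,
      ∀ x ∈ box 4 L, ∀ y ∈ box 4 L, ‖x - y‖ ≤ (L : ℝ) → T' * ‖x - y‖ ≤ ℓ β →
        |torusE G r β L (fun U => dens G r x U * dens G r y U) -
            torusE G r β L (dens G r x) * torusE G r β L (dens G r y)| ≤ W / (1 + ‖x - y‖) ^ 8)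
    (v : 𝓢(EuclideanSpace ℝ (Fin 4), ℝ)) (hv : tsupport v ⊆ {y : EuclideanSpace ℝ (Fin 4) | 0 < y 0})
    (hvc : HasCompactSupport v) {η : ℝ} (hη : 0 < η) :
    ∃ T β₁ : ℝ, ∀ β : ℝ, β₁ ≤ β → ∀ s : ℝ, 0 < s → T ≤ s * ℓ β →
      ∃ᶠ (L : ℕ) in atTop, |Q2 G r β L s (thetaTest 4 v) v| ≤ η := by
  classical
  -- a ball containing the support
  obtain ⟨ρ₀, hρ₀⟩ := (Metric.isBounded_iff_subset_closedBall (0 : EuclideanSpace ℝ (Fin 4))).1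
    hvc.isCompact.isBounded
  set ρ : ℝ := max ρ₀ 0 with hρ
  have hρ0 : 0 ≤ ρ := le_max_right _ _
  have hvρ : ∀ u : EuclideanSpace ℝ (Fin 4), v u ≠ 0 → ‖u‖ ≤ ρ := by
    intro u hu
    have hmem : u ∈ Metric.closedBall (0 : EuclideanSpace ℝ (Fin 4)) ρ₀ :=
      hρ₀ (subset_tsupport _ (Function.mem_support.2 hu))
    rw [Metric.mem_closedBall, dist_zero_right] at hmem
    exact hmem.trans (le_max_left _ _)
  have hθρ : ∀ u : EuclideanSpace ℝ (Fin 4), thetaTest 4 v u ≠ 0 → ‖u‖ ≤ ρ := by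
    intro u hu
    rw [thetaTest_apply] at hu
    have h := hvρ _ hu
    rwa [(timeReflection 4).norm_map] at h
  have hpair : ∀ (s : ℝ), 0 < s → ∀ x y : Site 4, thetaTest 4 v (s • siteToE x) ≠ 0 → v (s • siteToE y) ≠ 0 →
      s * ‖x - y‖ ≤ 2 * ρ := by
    intro s hs x y hx hy
    calc s * ‖x - y‖ ≤ ‖s • siteToE x - s • siteToE y‖ := mul_norm_sub_le_norm_smul_sub hs.le x y
      _ ≤ ‖s • siteToE x‖ + ‖s • siteToE y‖ := norm_sub_le _ _
      _ ≤ ρ + ρ := add_le_add (hθρ _ hx) (hvρ _ hy)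
      _ = 2 * ρ := by ring
  -- the cubic-vanishing constants of `θv` and `v`
  obtain ⟨Cθ, hCθ0, hCθ⟩ := exists_abs_thetaTest_le_cube_div v hv
  obtain ⟨Cv, hCv0, hCv⟩ := exists_abs_le_cube_div_of_tsupport v hv
  have hC0 : 0 ≤ max Cθ Cv := hCθ0.trans (le_max_left _ _)
  have hF : ∀ u : EuclideanSpace ℝ (Fin 4), |thetaTest 4 v u| ≤ max Cθ Cv * |u 0| ^ 3 / (1 + ‖u‖) ^ 10 :=
    fun u => (hCθ u).trans (by gcongr; exact le_max_left _ _)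
  have hG : ∀ u : EuclideanSpace ℝ (Fin 4), |v u| ≤ max Cθ Cv * |u 0| ^ 3 / (1 + ‖u‖) ^ 10 :=
    fun u => (hCv u).trans (by gcongr; exact le_max_right _ _)
  have hF0 : ∀ u : EuclideanSpace ℝ (Fin 4), 0 ≤ u 0 → thetaTest 4 v u = 0 :=
    thetaTest_apply_eq_zero_of_tsupport_subset v hv
  have hG0 : ∀ u : EuclideanSpace ℝ (Fin 4), u 0 ≤ 0 → v u = 0 := apply_eq_zero_of_tsupport_subset v hv
  obtain ⟨s₀, hs₀1, hlarge⟩ := exists_unit_forall_abs_Q2_thetaTest_le r v hv hη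
  set C : ℝ := max Cθ Cv with hC
  set Z₃ : ℝ := 3 ^ 3 * ∑' k : ℕ, (((k : ℝ) + 1) ^ 2)⁻¹ with hZ₃
  have hZ₃0 : 0 ≤ Z₃ := riemann_const_nonneg 3
  set J : ℝ := 64 * C ^ 2 * Z₃ ^ 2 * (max s₀ 1) ^ 3 with hJ
  have hJ0 : 0 ≤ J := by positivity
  set R : ℝ := 2 * ρ + 1 with hR
  have hR0 : 0 < R := by positivity
  obtain ⟨T', βa, hT'0, haf'⟩ := haf (η / (4 * (J + 1))) (by positivity)
  refine ⟨R * T', βa, fun β hβ s hs hT => ?_⟩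
  by_cases hs₀ : s₀ ≤ s
  · exact Filter.Eventually.frequently (Filter.Eventually.of_forall fun L => hlarge β L s hs₀)
  rw [not_le] at hs₀
  have hmin : 0 < min s 1 := lt_min hs one_pos
  have hsm : s / min s 1 ≤ max s₀ 1 := div_min_le_max hs hs₀.le
  have hsm0 : 0 ≤ s / min s 1 := by positivity
  have hwin : ∀ x y : Site 4, s * ‖x - y‖ ≤ R → T' * ‖x - y‖ ≤ ℓ β := by
    intro x y hxy
    have h1 : s * (T' * ‖x - y‖) ≤ s * ℓ β := by
      calc s * (T' * ‖x - y‖) = T' * (s * ‖x - y‖) := by ring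
        _ ≤ T' * R := mul_le_mul_of_nonneg_left hxy hT'0.le
        _ = R * T' := by ring
        _ ≤ s * ℓ β := hT
    exact le_of_mul_le_mul_left h1 hs
  have hL_ev : ∀ᶠ L : ℕ in atTop, 2 * ρ / s ≤ (L : ℝ) :=
    (Filter.eventually_ge_atTop ⌈2 * ρ / s⌉₊).mono fun L hL => (Nat.le_ceil _).trans (by exact_mod_cast hL)
  refine (((haf' β hβ).and hL_ev).mono fun L hL => ?_).frequently
  obtain ⟨hA', hLρ⟩ := hL
  have hnear : ∑ x ∈ box 4 L, ∑ y ∈ box 4 L,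
      |thetaTest 4 v (s • siteToE x)| * |v (s • siteToE y)| * ((1 + ‖x - y‖) ^ 8)⁻¹ ≤ J := by
    refine (doubleSum_kernel8_le hC0 hF hF0 hG hG0 hs (box 4 L) (box 4 L)).trans ?_
    rw [hJ]
    gcongr
  have hpt : ∀ x ∈ box 4 L, ∀ y ∈ box 4 L,
      |thetaTest 4 v (s • siteToE x) * v (s • siteToE y) *
          (torusE G r β L (fun U => dens G r x U * dens G r y U) -
            torusE G r β L (dens G r x) * torusE G r β L (dens G r y))| ≤
        η / (4 * (J + 1)) *
          (|thetaTest 4 v (s • siteToE x)| * |v (s • siteToE y)| * ((1 + ‖x - y‖) ^ 8)⁻¹) := by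
    intro x hx y hy
    refine abs_term_le_near_of_support (le_of_lt (by positivity)) x y
      (fun hL' hR' => hA' x hx y hy hL' (hwin x y hR')) (fun hx0 hy0 => ?_)
    have h2 := hpair s hs x y hx0 hy0
    refine ⟨by rw [hR]; linarith, ?_⟩
    have h3 : ‖x - y‖ ≤ 2 * ρ / s := by rw [le_div_iff₀ hs]; linarith
    exact h3.trans hLρ
  have hQ : Q2 G r β L s (thetaTest 4 v) v = ∑ x ∈ box 4 L, ∑ y ∈ box 4 L,
      thetaTest 4 v (s • siteToE x) * v (s • siteToE y) *
        (torusE G r β L (fun U => dens G r x U * dens G r y U) -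
          torusE G r β L (dens G r x) * torusE G r β L (dens G r y)) := rfl
  rw [hQ]
  calc |∑ x ∈ box 4 L, ∑ y ∈ box 4 L, thetaTest 4 v (s • siteToE x) * v (s • siteToE y) *
          (torusE G r β L (fun U => dens G r x U * dens G r y U) -
            torusE G r β L (dens G r x) * torusE G r β L (dens G r y))|
      ≤ ∑ x ∈ box 4 L, |∑ y ∈ box 4 L, thetaTest 4 v (s • siteToE x) * v (s • siteToE y) *
          (torusE G r β L (fun U => dens G r x U * dens G r y U) -
            torusE G r β L (dens G r x) * torusE G r β L (dens G r y))| := Finset.abs_sum_le_sum_abs _ _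
    _ ≤ ∑ x ∈ box 4 L, ∑ y ∈ box 4 L, |thetaTest 4 v (s • siteToE x) * v (s • siteToE y) *
          (torusE G r β L (fun U => dens G r x U * dens G r y U) -
            torusE G r β L (dens G r x) * torusE G r β L (dens G r y))| :=
        Finset.sum_le_sum fun x _ => Finset.abs_sum_le_sum_abs _ _
    _ ≤ ∑ x ∈ box 4 L, ∑ y ∈ box 4 L, η / (4 * (J + 1)) *
          (|thetaTest 4 v (s • siteToE x)| * |v (s • siteToE y)| * ((1 + ‖x - y‖) ^ 8)⁻¹) :=
        Finset.sum_le_sum fun x hx => Finset.sum_le_sum fun y hy => hpt x hx y hy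
    _ = η / (4 * (J + 1)) * ∑ x ∈ box 4 L, ∑ y ∈ box 4 L,
          |thetaTest 4 v (s • siteToE x)| * |v (s • siteToE y)| * ((1 + ‖x - y‖) ^ 8)⁻¹ := by
        simp only [Finset.mul_sum]
    _ ≤ η / (4 * (J + 1)) * J := by gcongr
    _ ≤ η / 4 := near_piece_le hη hJ0
    _ ≤ η := by linarith

end Compact

/-! ## §3 The X-clause and the registered stub from the covariance hypotheses -/
section XClause

/-- **cplan g10's contract lemma, re-proved** (`Sketch-g10-sharp.lean` §2 `afToOnset_clause_of_scale`, HOME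
`ym-cplan-19354-af-pincer/`; credit: planner ym-cplan-19354-af-pincer g10): the LEAD's «format at a mesh `≤ B·ℓ(β)`
eventually» and «asymptotic freedom below scale `ℓ`» give the registered X-clause at `(G, r, n, ε, δ)` (since then
`mixOnsetUc ≤ B·ℓ`, witness `T := B · max T₀ 0`). [folklore] -/
theorem xClause_of_formatAtScale_of_afBelowScale (r : LatticeRep G) {n : ℕ} {ε δ : ℝ} {ℓ : ℝ → ℝ}
    (hF : ∃ B β₂ : ℝ, 0 < B ∧ ∀ β : ℝ, β₂ ≤ β → ∃ b : ℕ, 1 ≤ b ∧ (b : ℝ) ≤ B * ℓ β ∧ TypShellCondUKPc r.ρ β b n ε δ)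
    (hA : ∀ v : 𝓢(EuclideanSpace ℝ (Fin 4), ℝ), tsupport v ⊆ {y : EuclideanSpace ℝ (Fin 4) | 0 < y 0} →
      ∀ η : ℝ, 0 < η → ∃ T β₁ : ℝ, ∀ β : ℝ, β₁ ≤ β → ∀ s : ℝ, 0 < s → T ≤ s * ℓ β →
        ∃ᶠ (L : ℕ) in atTop, |Q2 G r β L s (thetaTest 4 v) v| ≤ η)
    (v : 𝓢(EuclideanSpace ℝ (Fin 4), ℝ)) (hv : tsupport v ⊆ {y : EuclideanSpace ℝ (Fin 4) | 0 < y 0})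
    {η : ℝ} (hη : 0 < η) :
    ∃ T β₁ : ℝ, ∀ β : ℝ, β₁ ≤ β → ∀ s : ℝ, 0 < s → T ≤ s * (mixOnsetUc r.ρ β n ε δ : ℝ) →
      ∃ᶠ (L : ℕ) in atTop, |Q2 G r β L s (thetaTest 4 v) v| ≤ η := by
  obtain ⟨T₀, β₁, hT₀⟩ := hA v hv η hη
  obtain ⟨B, β₂, hB, hFβ⟩ := hF
  refine ⟨B * max T₀ 0, max β₁ β₂, fun β hβ s hs hT => ?_⟩
  have hβ1 : β₁ ≤ β := le_trans (le_max_left _ _) hβ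
  have hβ2 : β₂ ≤ β := le_trans (le_max_right _ _) hβ
  obtain ⟨b, hb1, hbℓ, hP⟩ := hFβ β hβ2
  have hle : mixOnsetUc r.ρ β n ε δ ≤ b := fmtOnset_le (fun β' b => TypShellCondUKPc r.ρ β' b n ε δ) β hb1 hP
  have hle' : (mixOnsetUc r.ρ β n ε δ : ℝ) ≤ (b : ℝ) := by exact_mod_cast hle
  have h1 : B * max T₀ 0 ≤ B * (s * ℓ β) := by
    calc B * max T₀ 0 ≤ s * (mixOnsetUc r.ρ β n ε δ : ℝ) := hT
      _ ≤ s * (b : ℝ) := mul_le_mul_of_nonneg_left hle' hs.le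
      _ ≤ s * (B * ℓ β) := mul_le_mul_of_nonneg_left hbℓ hs.le
      _ = B * (s * ℓ β) := by ring
  have h2 : max T₀ 0 ≤ s * ℓ β := le_of_mul_le_mul_left h1 hB
  exact hT₀ β hβ1 s hs ((le_max_left _ _).trans h2)

/-- **The X-clause at `(G, r, n, ε, δ)` from the covariance hypotheses AT THE ONSET SCALE `ℓ = b⋆ = mixOnsetUc`**
(generation 0's «what is missing», `NOTES-S2-g0.md` §Census, now a kernel implication): the crossover envelope and the
asymptotic-freedom window «`|Cov| ≤ W (1+‖x−y‖)⁻⁸` whenever `T'(W)·‖x − y‖ ≤ b⋆(β)`» imply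
`∀ v η, ∃ T β₁, ∀ β ≥ β₁, ∀ s > 0, T ≤ s·b⋆(β) → ∃ᶠ L, |Q2 G r β L s (θv) v| ≤ η`. [folklore reduction; hypotheses OPEN] -/
theorem xClause_of_covarianceAF_at_onset (r : LatticeRep G) (n : ℕ) (ε δ : ℝ)
    (henv : ∃ W₀ β₀ : ℝ, ∀ β : ℝ, β₀ ≤ β → ∀ᶠ L : ℕ in atTop, ∀ x ∈ box 4 L, ∀ y ∈ box 4 L,
      ‖x - y‖ ≤ (L : ℝ) →
        |torusE G r β L (fun U => dens G r x U * dens G r y U) -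
            torusE G r β L (dens G r x) * torusE G r β L (dens G r y)| ≤ W₀ / (1 + ‖x - y‖) ^ 8)
    (haf : ∀ W : ℝ, 0 < W → ∃ T' β₀ : ℝ, 0 < T' ∧ ∀ β : ℝ, β₀ ≤ β → ∀ᶠ L : ℕ in atTop,
      ∀ x ∈ box 4 L, ∀ y ∈ box 4 L, ‖x - y‖ ≤ (L : ℝ) → T' * ‖x - y‖ ≤ (mixOnsetUc r.ρ β n ε δ : ℝ) →
        |torusE G r β L (fun U => dens G r x U * dens G r y U) -
            torusE G r β L (dens G r x) * torusE G r β L (dens G r y)| ≤ W / (1 + ‖x - y‖) ^ 8)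
    (v : 𝓢(EuclideanSpace ℝ (Fin 4), ℝ)) (hv : tsupport v ⊆ {y : EuclideanSpace ℝ (Fin 4) | 0 < y 0})
    {η : ℝ} (hη : 0 < η) :
    ∃ T β₁ : ℝ, ∀ β : ℝ, β₁ ≤ β → ∀ s : ℝ, 0 < s → T ≤ s * (mixOnsetUc r.ρ β n ε δ : ℝ) →
      ∃ᶠ (L : ℕ) in atTop, |Q2 G r β L s (thetaTest 4 v) v| ≤ η :=
  afBelowScale_of_covarianceAF r (fun β => (mixOnsetUc r.ρ β n ε δ : ℝ)) henv haf v hv hη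

/-- **The registered stub's statement `AFToOnsetUKPc` BY NAME from the covariance hypotheses at every parameter**:
if for every compact simple `G` (Borel σ-algebra) and every lattice representation `r` the crossover envelope holds, and
for every admissible `(n, ε)` and `δ > 0` the asymptotic-freedom window holds at the onset scale `b⋆ = mixOnsetUc`, then
`AFToOnsetUKPc`.  (This does NOT prove the stub: both hypotheses are open statements about weak-coupling 4-d
non-abelian lattice gauge theory; it records exactly what the X-desk owes in covariance language.) [folklore reduction] -/
theorem afToOnsetUKPc_of_covarianceAF
    (henv : ∀ (G : Type) [Group G] [TopologicalSpace G] [IsTopologicalGroup G] [CompactSpace G],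
      IsCompactSimpleLieGroup G → letI : MeasurableSpace G := borel G; haveI : BorelSpace G := ⟨rfl⟩;
      ∀ r : LatticeRep G, ∃ W₀ β₀ : ℝ, ∀ β : ℝ, β₀ ≤ β → ∀ᶠ L : ℕ in atTop, ∀ x ∈ box 4 L, ∀ y ∈ box 4 L,
        ‖x - y‖ ≤ (L : ℝ) →
          |torusE G r β L (fun U => dens G r x U * dens G r y U) -
              torusE G r β L (dens G r x) * torusE G r β L (dens G r y)| ≤ W₀ / (1 + ‖x - y‖) ^ 8)
    (haf : ∀ (G : Type) [Group G] [TopologicalSpace G] [IsTopologicalGroup G] [CompactSpace G],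
      IsCompactSimpleLieGroup G → letI : MeasurableSpace G := borel G; haveI : BorelSpace G := ⟨rfl⟩;
      ∀ (r : LatticeRep G) (n : ℕ) (ε : ℝ), 1 ≤ n → 0 ≤ ε → ε * OnsetFormats.shellCount n ≤ 3 / 4 → ∀ δ : ℝ, 0 < δ →
        ∀ W : ℝ, 0 < W → ∃ T' β₀ : ℝ, 0 < T' ∧ ∀ β : ℝ, β₀ ≤ β → ∀ᶠ L : ℕ in atTop,
          ∀ x ∈ box 4 L, ∀ y ∈ box 4 L, ‖x - y‖ ≤ (L : ℝ) → T' * ‖x - y‖ ≤ (mixOnsetUc r.ρ β n ε δ : ℝ) →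
            |torusE G r β L (fun U => dens G r x U * dens G r y U) -
                torusE G r β L (dens G r x) * torusE G r β L (dens G r y)| ≤ W / (1 + ‖x - y‖) ^ 8) :
    AFToOnsetUKPc := by
  intro G _ _ _ _ hG
  letI : MeasurableSpace G := borel G
  haveI : BorelSpace G := ⟨rfl⟩
  intro r n ε hn hε hM δ hδ v hv η hη
  exact xClause_of_covarianceAF_at_onset r n ε δ (henv G hG r) (haf G hG r n ε hn hε hM δ hδ) v hv hη

end XClause

/-! ## §4 Non-vacuity: the window hypothesis at the polynomial scale is a theorem of the tree -/
section NonVacuity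

/-- `(√(√z))⁸ = z²` for `z ≥ 0`. [folklore] -/
theorem sqrt_sqrt_pow_eight {z : ℝ} (hz : 0 ≤ z) : Real.sqrt (Real.sqrt z) ^ 8 = z ^ 2 := by
  rw [show (8 : ℕ) = 2 * (2 * 2) by norm_num, pow_mul, Real.sq_sqrt (Real.sqrt_nonneg _), pow_mul,
    Real.sq_sqrt hz]

/-- **Non-vacuity of the asymptotic-freedom window.**  At the polynomial scale `ℓ(β) = (β/(1 + log β))^{1/4}` the
window hypothesis of `afBelowScale_of_covarianceAF` HOLDS for every lattice representation, unconditionally: for every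
`W > 0` there are `T' > 0, β₀` with `|Cov_{β,L}(A_x, A_y)| ≤ W (1+‖x−y‖)⁻⁸` whenever `T'‖x − y‖ ≤ ℓ(β)`, `β ≥ β₀`,
`L ≥ 1` (from the tree's `|Cov| ≤ W₁ (1+log β)²/β²`: `(1+‖x−y‖)⁸ ≤ 256 max(1, ℓ⁸/T'⁸)` and `ℓ⁸ (1+log β)²/β² = 1`).
The stub needs the window at the onset scale `b⋆ = mixOnsetUc` instead (generation 0: `≍ (β/log β)^{1/4}` is exactly
the reach of variance-only methods). [folklore] -/
theorem covarianceAF_window_polyScale (r : LatticeRep G) (W : ℝ) (hW : 0 < W) :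
    ∃ T' β₀ : ℝ, 0 < T' ∧ ∀ β : ℝ, β₀ ≤ β → ∀ᶠ L : ℕ in atTop, ∀ x ∈ box 4 L, ∀ y ∈ box 4 L,
      ‖x - y‖ ≤ (L : ℝ) → T' * ‖x - y‖ ≤ Real.sqrt (Real.sqrt (β / (1 + Real.log β))) →
        |torusE G r β L (fun U => dens G r x U * dens G r y U) -
            torusE G r β L (dens G r x) * torusE G r β L (dens G r y)| ≤ W / (1 + ‖x - y‖) ^ 8 := by
  obtain ⟨W₁, hW₁0, hW₁⟩ := exists_abs_torusCov_dens_le r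
  set T' : ℝ := max 1 (256 * W₁ / W) with hT'
  have hT'1 : 1 ≤ T' := le_max_left _ _
  have hT'0 : 0 < T' := lt_of_lt_of_le one_pos hT'1
  refine ⟨T', max 1 (1024 * W₁ / W), hT'0, fun β hβ => ?_⟩
  have hβ1 : 1 ≤ β := le_trans (le_max_left _ _) hβ
  have hβ0 : 0 < β := lt_of_lt_of_le one_pos hβ1
  have hlog : 0 ≤ Real.log β := Real.log_nonneg hβ1
  have hl1 : 0 < 1 + Real.log β := by linarith
  set ℓ : ℝ := Real.sqrt (Real.sqrt (β / (1 + Real.log β))) with hℓ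
  have hℓ0 : 0 ≤ ℓ := Real.sqrt_nonneg _
  have hℓ8 : ℓ ^ 8 * ((1 + Real.log β) ^ 2 / β ^ 2) = 1 := by
    rw [hℓ, sqrt_sqrt_pow_eight (by positivity)]
    field_simp
  have hq : (1 + Real.log β) ^ 2 / β ^ 2 ≤ 4 / β := by
    rw [div_le_div_iff₀ (by positivity) hβ0]
    nlinarith [one_add_log_sq_le hβ1]
  refine (Filter.eventually_ge_atTop 1).mono fun L hL x _ y _ _ hd => ?_
  have hcov := hW₁ L hL β hβ1 x y
  have hpos : 0 < (1 + ‖x - y‖) ^ 8 := by positivity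
  rw [le_div_iff₀ hpos]
  refine (mul_le_mul_of_nonneg_right hcov hpos.le).trans ?_
  have hd' : ‖x - y‖ ≤ ℓ / T' := by rw [le_div_iff₀ hT'0, mul_comm]; exact hd
  by_cases hcase : ℓ / T' ≤ 1
  · -- `(1+‖x−y‖)⁸ ≤ 256` and `W₁ (1+log β)²/β² · 256 ≤ 1024 W₁/β ≤ W`
    have h1 : (1 + ‖x - y‖) ^ 8 ≤ 2 ^ 8 := pow_le_pow_left₀ (by positivity) (by linarith) 8
    have hβW : 1024 * W₁ / W ≤ β := le_trans (le_max_right _ _) hβ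
    have h2 : 1024 * W₁ ≤ W * β := by rw [div_le_iff₀ hW] at hβW; linarith
    calc W₁ * (1 + Real.log β) ^ 2 / β ^ 2 * (1 + ‖x - y‖) ^ 8 ≤ W₁ * (4 / β) * 2 ^ 8 := by
          rw [mul_div_assoc]
          exact mul_le_mul (mul_le_mul_of_nonneg_left hq hW₁0) h1 (by positivity) (by positivity)
      _ = 1024 * W₁ / β := by ring
      _ ≤ W := by rw [div_le_iff₀ hβ0]; linarith
  · -- `1 + ‖x−y‖ ≤ 2ℓ/T'`, `(1+‖x−y‖)⁸ ≤ 256 ℓ⁸/T'⁸` and `ℓ⁸ (1+log β)²/β² = 1`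
    rw [not_le] at hcase
    have h1 : (1 + ‖x - y‖) ^ 8 ≤ (2 * (ℓ / T')) ^ 8 := pow_le_pow_left₀ (by positivity) (by linarith) 8
    have hT'8 : 256 * W₁ / W ≤ T' ^ 8 := (le_max_right _ _).trans (le_self_pow₀ hT'1 (by norm_num))
    have h2 : 256 * W₁ ≤ W * T' ^ 8 := by rw [div_le_iff₀ hW] at hT'8; linarith
    have hT'8pos : 0 < T' ^ 8 := by positivity
    calc W₁ * (1 + Real.log β) ^ 2 / β ^ 2 * (1 + ‖x - y‖) ^ 8
        ≤ W₁ * (1 + Real.log β) ^ 2 / β ^ 2 * (2 * (ℓ / T')) ^ 8 :=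
          mul_le_mul_of_nonneg_left h1 (by positivity)
      _ = 256 * W₁ / T' ^ 8 * (ℓ ^ 8 * ((1 + Real.log β) ^ 2 / β ^ 2)) := by
          rw [mul_pow, div_pow]; ring
      _ = 256 * W₁ / T' ^ 8 := by rw [hℓ8, mul_one]
      _ ≤ W := by rw [div_le_iff₀ hT'8pos]; linarith

end NonVacuity



end Summit.QuantumFields.YangMills.Cruxes.IR.AfPincerUc

end
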